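import Summits.QuantumFields.YangMills.Theorems.BalabanUVNodesN11BgRowGaugeROfHcubeOmega
import Summits.QuantumFields.YangMills.Theorems.BalabanUVNodesN11BgRowOfPowM
import Summits.QuantumFields.YangMills.Theorems.BalabanUVNodesN11K0DoorAtCRLetteredNumerics

/-!
# DAG node N11 × K1 — ROW P11 `bg` AT THE cR-LETTERED MEMBERS OF K1's WITNESS NUMERICS (`s2.cR := c`, `0 < c ≤ 8`) ON EVERY WINDOW RUN, NO RUN GUARD: this seat's GaugeR
# re-thread (p623895) at dag-n11-w3 g4's member letters, `hcube` from dag-n11-w4 g4's «BG-ONEBLOCK» §1, `hsN` from the family letter `j + 1 ≤ F.m` — the `hbgs` of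
# dag-n11-w1 g3's `…OfBgFacts` consumers where their `2 ≤ cR` binder is inhabitable

HEADER — WORK-UNIT METADATA.  Cell `pub-ymgap`, YM-PLAN Track A (HUMAN RULING D-0062 ∕ D-0149 ∕ D-0154 width seats), seat `pub-ymgap-dag-n11-w5` (g2; WIDTH SEAT 5 on NODE n11
[B14]; dag-n11-w1 g3's OFFER (n1) «CAPSTONE at a cR-lettered member … natural pen n11-w3 g4 or n11-w5», INBOX l.36654 — dag-n11-w3 g4 closed before it; CLAIM-4 l.36707),
route `BalabanUVNodes` rev 29, item K1⁹ `StabilityBRunRowsAtRecordR13SepCoPHV` = stmt-QuantumFields-27364 (helper lane, `--kind proof --supports 27364 --as helper`, count-neutral).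
[III] = [Balaban1988Convergent], [I] = [Balaban1987RG1], [15] = [Balaban1985Variational], [6] = [Balaban1985RegularSpaces].  Over this seat's p623895
`…N11BgRowGaugeROfHcubeOmega` (§4 `stage13_bgAtDatumCoP_of_thm1RegSepCoP7M_of_thm1GaugeR_of_hcubeΩ` — B′'s Stage-13 reduction with `hcubeΩ` as a hypothesis and NO `PartCompat₁₃`),
dag-n11-w4 g4's p624439 `…N11BgRowOfPowM` (`hcubeΩ_of_powM`), dag-n11-w3 g4's p620936 `…N11K0DoorAtCRLetteredNumerics` (the member's letters `hnum_ccmwCR` ∕ `εreg_le_ccmwCR` ∕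
`hC1_ccmwCR` ∕ `hBα_ccmwCR` ∕ `htI_ccmwCR` ∕ `htMS_ccmwCR`, and its GUARDED §2 `bgSepCoPAt_ccmwCR_of_thm1GaugeR_of_hcomp_allTorus` :277 whose statement §1 repeats WITHOUT the
guard), dag-n21-c's `Node00/Record13LettersOfThm1CCMW` (`hsN_theta13OfThm1CCMW`).

WHY THIS FILE.  dag-n11-w1 g3's `…OfBgFacts` faces (p626869 ∕ p627901: N11's PRINTED OUTPUT at the Gaussian certificate with the run guard DROPPED) display `hbgs : ∀ P, window →
∀ k ≤ K, BgProvisoΛ … k …` and `2 ≤ cR`.  At K1's witness of record `θ₁₅ᶜᶜᴹᵂ(j; γ)` this seat's p626404 supplies `hbgs` but `cR = 1` there (LOCATED-cR); at dag-n11-w3 g4's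
cR-LETTERED MEMBERS `{θ₁₅ᶜᶜᴹᵂ numerics with s2.cR := c}`, `2 ≤ c ≤ 8`, the binder `2 ≤ cR` is `le`-true and every other K1 letter is `rfl`-unchanged — but their row P11 came only
GUARDED (dag-n21-c's all-torus engine).  THIS FILE supplies it there WITHOUT the guard: §1 re-runs n11-w3's :277 through p623895 §4 (one engine swapped; `hcube` := `hcubeΩ_of_powM`
at `M = L^j` ∘ `hC1_ccmwCR`; `hsN` := `hsN_theta13OfThm1CCMW hjm`, the member's `τ9.M` being θ₁₅ᶜᶜᴹᵂ's `L^j` definitionally), §2 packages it in `BgProvisoΛ` currency, §3 hands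
the consumers' `hbgs` binder verbatim at every H-extension and every window `γ' ≤ θ.γ`.  The sequel `…N11Thm1PrintedAtCRLetteredMemberOfBgFacts` plugs §3 into p627901.

WHAT THIS FILE PROVES (0 `sorry`, 0 `def`; one re-thread + two compositions BY NAME; nothing of Bałaban asserted).
§1 ★★★ `bgSepCoPAt_ccmwCR_of_thm1GaugeR_of_hcomp_of_hjm` · §2 ★★★ `bgProvisoΛ_ccmwCR_of_thm1GaugeR_of_hcomp_of_hjm` · §3 ★★★ `bgFacts_ccmwCRH_of_thm1GaugeR_of_hcomp_of_hjm`.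

HONEST FRAMING.  Helper lane of K1⁹; count-neutral; CONDITIONAL on the [15] letters (8) `VariationalThm1RegSepCoP7M` and (9) `VariationalThm1GaugeRegSepCoP7MR` (Props with
parameters, inhabited nowhere), on (hcomp) ∧ (hcompRev), the window `0 < γ ≤ ½`, the six signs, `0 < c ≤ 8`, `hjm : j + 1 ≤ F.m` — all DISPLAYED; NOT a discharge; NOT a re-pin of
any witness of record (the member is a re-lettered copy; at `c := 1` it IS θ₁₅ᶜᶜᴹᵂ); `Provisos₁₃SepCoPH.bg`'s type untouched.  N11 ∕ N07 NOT discharged; K0⁷ ∕ K1⁹ NOT closed;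
counts unmoved (typed 28∕28 · discharged 5∕27); no summit statement is proved by this seat.  R4 closes only the conditional finite-𝕋⁴ rung `BalabanLadder.UV` of one programme at
fixed `ε = L^{−K}` — NOT ℝ⁴, NOT OS, NOT a mass gap, NOT Clay.  No `sorry`, `axiom`, `def`, `instance`, `notation`.
Sources (SHAPE ∕ bookkeeping only): [III] Thm 1 p.262, (2.1) p.254, (2.4)–(2.8) pp.255–256, (2.12)–(2.13) pp.256–257, (2.18) p.257, (2.25)–(2.28) pp.258–259; [15] (6)–(7) p.278,
Thm 1 (8)–(9) p.279, (144)–(152) pp.300–301, Prop. 8 p.304; [6] (1.3)–(1.9) p.77; [I] Thm 1 p.259, (0.1) p.251, (1.12) p.262.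
-/

noncomputable section

open MeasureTheory
open scoped Matrix.Norms.L2Operator

namespace Summit.QuantumFields.YangMills.Theorems.BalabanUVNodesN11BgRowGaugeRAtCRLetteredMember

open Literature.MathematicalPhysics.QuantumFieldTheory.Balaban1983to89 Node00
open T4Continuum B14.Eq218Concrete B15DeterminingSets FlowStep FlowStepRuns B12RegularSpaces111 B14RegularSpaces234
open BalabanUVNodesN11BgRowGaugeROfHcubeOmega (stage13_bgAtDatumCoP_of_thm1RegSepCoP7M_of_thm1GaugeR_of_hcubeΩ)
open BalabanUVNodesN11BgRowOfPowM (hcubeΩ_of_powM)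
open BalabanUVNodesN11K0DoorAtCRLetteredNumerics (hnum_ccmwCR εreg_le_ccmwCR hC1_ccmwCR hBα_ccmwCR htI_ccmwCR htMS_ccmwCR)

variable {F : T4Family} {N : ℕ} [NeZero N] {j c₁₅ : ℕ} {γ c ε₀ ε₂₉ B₃ B₃' a₀ a₁ : ℝ} {θ : Stage13Params F N}

/-- **§1 ★★★ THE (7)-GUARDED SEPARATED ROW P11 AT THE Co CARRIER AT THE cR-LETTERED MEMBER ON EVERY WINDOW RUN — NO RUN GUARD**, for `0 < c ≤ 8` and non-wrapping families
`j + 1 ≤ F.m`: dag-n11-w3 g4's `…K0DoorAtCRLetteredNumerics.bgSepCoPAt_ccmwCR_of_thm1GaugeR_of_hcomp_allTorus` (:277) with dag-n21-c's guarded engine `…_allTorus` REPLACED by this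
seat's p623895 `stage13_bgAtDatumCoP_of_thm1RegSepCoP7M_of_thm1GaugeR_of_hcubeΩ` — its `hcube` fed by dag-n11-w4's p624439 `hcubeΩ_of_powM` at `M = L^j` (`rfl` at the member) with
(C1) `hC1_ccmwCR` in the window, its `hsN` by the family letter (`hsN_theta13OfThm1CCMW hjm`; the member's `τ9` is θ₁₅ᶜᶜᴹᵂ's) — and the antecedent `PartCompat₁₃ … →` DELETED.
Letters `hnum ∕ εreg ∕ hBα ∕ htI ∕ htMS_ccmwCR` BY NAME; statement otherwise = :277's.  CONDITIONAL; nothing of Bałaban asserted.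
[cite: Balaban1985Variational, (6)–(7) p.278, Thm 1 (8)–(9) p.279, (144)–(152) pp.300–301, Prop. 8 p.304; Balaban1985RegularSpaces, (1.3)–(1.9) p.77; Balaban1988Convergent, Thm 1 p.262, (2.1) p.254, (2.4)–(2.8) pp.255–256, (2.10) p.256, (2.12)–(2.13) pp.256–257, (2.18) p.257, (2.25)–(2.28) pp.258–259; Balaban1987RG1, Thm 1 p.259, (1.12) p.262] -/
theorem bgSepCoPAt_ccmwCR_of_thm1GaugeR_of_hcomp_of_hjm (hθ : θ = theta13LiveOfNumerics F N
      ({ stage12NumericsOfThm1CCMW F.L j γ ε₀ B₃ B₃' a₀ a₁ with s2 := { sect2NumericsOfThm1C F.L with cR := c } } : Stage12Numerics) ε₂₉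
      (zeta316OfRecord F N (stage12NumericsOfThm1CCMW F.L j γ ε₀ B₃ B₃' a₀ a₁).ν (stage12NumericsOfThm1CCMW F.L j γ ε₀ B₃ B₃' a₀ a₁).τ9.M
        (stage12NumericsOfThm1CCMW F.L j γ ε₀ B₃ B₃' a₀ a₁).A₁) (RzOfRecord F N) (ZtOfRecord F N))
    (hjm : j + 1 ≤ F.m) (hc0 : 0 < c) (hc8 : c ≤ 8) (hγ0 : 0 < γ) (hγ : γ ≤ 1 / 2) (hε : 0 < ε₀) (hε' : 0 < ε₂₉) (hB : 0 ≤ B₃) (hB' : 0 ≤ B₃') (ha₀ : 0 < a₀) (ha₁ : 0 < a₁)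
    (h15 : VariationalThm1RegSepCoP7M F N B₃ a₀ a₁) (hc₁₅ : c₁₅ ≤ F.L ^ j) (h15G : VariationalThm1GaugeRegSepCoP7MR F N (F.L ^ j) c₁₅ B₃ B₃' a₀ a₁)
    (hcomp : ∀ (p : B12.RunParams) (n : ℕ), n ≤ p.K → Step.InInterval θ.γ n (gOfRecord₁₃ F N θ p) → ∀ m, m < n →
      θ.s2.cR * epsOfRecord θ.ν (gOfRecord₁₃ F N θ p) m ≤ 2 * (θ.s2.cR * epsOfRecord θ.ν (gOfRecord₁₃ F N θ p) (m + 1)))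
    (hcompRev : ∀ (p : B12.RunParams) (n : ℕ), n ≤ p.K → Step.InInterval θ.γ n (gOfRecord₁₃ F N θ p) → ∀ m, m < n →
      θ.s2.cR * epsOfRecord θ.ν (gOfRecord₁₃ F N θ p) (m + 1) ≤ 2 * (θ.s2.cR * epsOfRecord θ.ν (gOfRecord₁₃ F N θ p) m)) :
    ∀ (p : B12.RunParams) (n : ℕ), n ≤ p.K → Step.InInterval θ.γ n (gOfRecord₁₃ F N θ p) →
      ∀ s : SeqOfRecord F θ.ν θ.τ9.M (gOfRecord₁₃ F N θ p) p.K n, Sect2.SeqSeparated θ.ν.M₁ s →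
      ∀ W : MSField (F.P p.K) (SU N), W ∈ suppOfRecord₁₃P F N θ p n s →
      Sect2.DataSmall7PTop (avOfRecord F N p.K) s.Ω (suppDomOfRecord F θ.ν p.K s.Ω) n (fun j' => θ.s2.cR * epsOfRecord θ.ν (gOfRecord₁₃ F N θ p) j') W →
      ∀ j', 1 ≤ j' → j' ≤ n → ∀ X : (Sect2.domSys (F.P p.K) θ.τ9.M j').Dom,
      (Sect2.domSites (F.P p.K) θ.τ9.M j' X ⊆ s.Λ j' →
        Sect2.ofBackgroundC (settingOfRecord₁₃ F N θ p).ι (UbgOfRecord₁₃CoP F N θ p n s W) ∈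
          Sect2.spaceI (settingOfRecord₁₃ F N θ p) (θ.Rz p.K) θ.τ9.M j' (Sect2.domSites (F.P p.K) θ.τ9.M j' X)
            ((settingOfRecord₁₃ F N θ p).lf.alpha0 ((settingOfRecord₁₃ F N θ p).flow.g j')) ((settingOfRecord₁₃ F N θ p).lf.alpha1 ((settingOfRecord₁₃ F N θ p).flow.g j'))) ∧
      (Sect2.admB (F.P p.K) θ.ν θ.τ9.M (gOfRecord₁₃ F N θ p) s.Ω s.Λ j' (Sect2.domSites (F.P p.K) θ.τ9.M j' X) = true →
        Sect2.ofBackgroundC (settingOfRecord₁₃ F N θ p).ι (UbgOfRecord₁₃CoP F N θ p n s W) ∈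
          Sect2.spaceMS (settingOfRecord₁₃ F N θ p) (θ.Rz p.K) θ.τ9.M j' (Sect2.domSites (F.P p.K) θ.τ9.M j' X) s.Ω) := by
  have hnum := hnum_ccmwCR hθ hc0 hc8 hγ hB hB' ha₀ ha₁
  have hεreg := εreg_le_ccmwCR hθ
  have hBα := hBα_ccmwCR hθ hc0.le (by linarith) hγ hB hB' ha₀.le ha₁.le
  have htI := htI_ccmwCR hθ hc0.le (by linarith) hγ hB hB' ha₀.le ha₁.le
  have htMS := htMS_ccmwCR hθ hc0.le (by linarith) hγ hB hB' ha₀.le ha₁.le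
  have hC1 := hC1_ccmwCR hθ hγ
  subst hθ
  -- the (1.12)-cube inclusion WITHOUT (C2): dag-n11-w4's `hcubeΩ_of_powM` at `M = L^j` with (C1) in the window
  have hcube := fun (p : B12.RunParams) (n : ℕ) (hn : n ≤ p.K) hw s =>
    hcubeΩ_of_powM (F := F) _ (show 0 < F.L ^ j from pow_pos (by have := F.hL11; omega) _) (a := j) rfl _ p.K n s (hC1 p n hn hw)
  -- the no-wrap letter from the family letter `j + 1 ≤ F.m` (the member's `M` is θ₁₅ᶜᶜᴹᵂ's `L^j`)
  have hsN := hsN_theta13OfThm1CCMW F N γ ε₀ ε₂₉ B₃ B₃' a₀ a₁ hjm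
  have hγ1 : γ < 1 := hγ.trans_lt (by norm_num)
  have hpos : ({ stage12NumericsOfThm1CCMW F.L j γ ε₀ B₃ B₃' a₀ a₁ with s2 := { sect2NumericsOfThm1C F.L with cR := c } } : Stage12Numerics).Pos := by
    obtain ⟨h1, h2, h3, h4, h5, h6, -, h8, h9⟩ := stage12NumericsOfThm1CCMW_pos (j := j) F.hL.2.le hγ0 hγ1 hε hB hB' ha₀ ha₁
    exact ⟨h1, h2, h3, h4, h5, h6, hc0, h8, h9⟩
  have hadm := (admissible_theta13OfNumerics
    (n := ({ stage12NumericsOfThm1CCMW F.L j γ ε₀ B₃ B₃' a₀ a₁ with s2 := { sect2NumericsOfThm1C F.L with cR := c } } : Stage12Numerics)) F N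
    (zeta316OfRecord F N (stage12NumericsOfThm1CCMW F.L j γ ε₀ B₃ B₃' a₀ a₁).ν (stage12NumericsOfThm1CCMW F.L j γ ε₀ B₃ B₃' a₀ a₁).τ9.M
      (stage12NumericsOfThm1CCMW F.L j γ ε₀ B₃ B₃' a₀ a₁).A₁) (RzOfRecord F N) (ZtOfRecord F N) hpos hε').liveRepin₁₃
  intro p n hn hw s hsep W _ h7
  cases n with
  | zero => intro j' h1 hj'; exfalso; omega
  | succ n =>
    rw [UbgOfRecord₁₃CoP_succ]
    exact stage13_bgAtDatumCoP_of_thm1RegSepCoP7M_of_thm1GaugeR_of_hcubeΩ _ hadm rfl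
      (show c₁₅ ≤ F.L ^ j from hc₁₅) h15 h15G hnum hεreg
      hcomp hcompRev hBα htI htMS hcube hsN p (n + 1) hn hw s hsep (show 0 < F.L ^ j from pow_pos (by have := F.hL11; omega) _) W h7

/-- **§2 ★★★ ROW P11 IN ITS OWN CURRENCY AT THE MEMBER ON EVERY WINDOW RUN — NO RUN GUARD**: `BgProvisoΛ … n (suppOfRecord₁₃SepCoP …) (UbgOfRecord₁₃CoP …)` (the TYPE of
`Provisos₁₃SepCoPH.bg`'s consequent) from §1 through K0a's support adapter (`suppOfRecord₁₃SepCoP` membership = ⟨`suppOfRecord₁₃P`, separation, (7)⟩).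
[cite: Balaban1988Convergent, (2.28) p.259, (2.18) p.257, Thm 1 p.262; Balaban1985Variational, (6)–(7) p.278, Thm 1 (8)–(9) p.279; Balaban1985RegularSpaces, (1.3)–(1.6) p.77] -/
theorem bgProvisoΛ_ccmwCR_of_thm1GaugeR_of_hcomp_of_hjm (hθ : θ = theta13LiveOfNumerics F N
      ({ stage12NumericsOfThm1CCMW F.L j γ ε₀ B₃ B₃' a₀ a₁ with s2 := { sect2NumericsOfThm1C F.L with cR := c } } : Stage12Numerics) ε₂₉
      (zeta316OfRecord F N (stage12NumericsOfThm1CCMW F.L j γ ε₀ B₃ B₃' a₀ a₁).ν (stage12NumericsOfThm1CCMW F.L j γ ε₀ B₃ B₃' a₀ a₁).τ9.M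
        (stage12NumericsOfThm1CCMW F.L j γ ε₀ B₃ B₃' a₀ a₁).A₁) (RzOfRecord F N) (ZtOfRecord F N))
    (hjm : j + 1 ≤ F.m) (hc0 : 0 < c) (hc8 : c ≤ 8) (hγ0 : 0 < γ) (hγ : γ ≤ 1 / 2) (hε : 0 < ε₀) (hε' : 0 < ε₂₉) (hB : 0 ≤ B₃) (hB' : 0 ≤ B₃') (ha₀ : 0 < a₀) (ha₁ : 0 < a₁)
    (h15 : VariationalThm1RegSepCoP7M F N B₃ a₀ a₁) (hc₁₅ : c₁₅ ≤ F.L ^ j) (h15G : VariationalThm1GaugeRegSepCoP7MR F N (F.L ^ j) c₁₅ B₃ B₃' a₀ a₁)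
    (hcomp : ∀ (p : B12.RunParams) (n : ℕ), n ≤ p.K → Step.InInterval θ.γ n (gOfRecord₁₃ F N θ p) → ∀ m, m < n →
      θ.s2.cR * epsOfRecord θ.ν (gOfRecord₁₃ F N θ p) m ≤ 2 * (θ.s2.cR * epsOfRecord θ.ν (gOfRecord₁₃ F N θ p) (m + 1)))
    (hcompRev : ∀ (p : B12.RunParams) (n : ℕ), n ≤ p.K → Step.InInterval θ.γ n (gOfRecord₁₃ F N θ p) → ∀ m, m < n →
      θ.s2.cR * epsOfRecord θ.ν (gOfRecord₁₃ F N θ p) (m + 1) ≤ 2 * (θ.s2.cR * epsOfRecord θ.ν (gOfRecord₁₃ F N θ p) m)) :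
    ∀ (p : B12.RunParams) (n : ℕ), n ≤ p.K → Step.InInterval θ.γ n (gOfRecord₁₃ F N θ p) →
      BgProvisoΛ F N p.K (settingOfRecord₁₃ F N θ p) (θ.Rz p.K) θ.τ9.M n (suppOfRecord₁₃SepCoP F N θ p n) (UbgOfRecord₁₃CoP F N θ p n) := by
  intro p n hn hw s W hW
  exact bgSepCoPAt_ccmwCR_of_thm1GaugeR_of_hcomp_of_hjm hθ hjm hc0 hc8 hγ0 hγ hε hε' hB hB' ha₀ ha₁ h15 hc₁₅ h15G hcomp hcompRev
    p n hn hw s hW.2.1 W hW.1 hW.2.2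

/-- **§3 ★★★ THE `hbgs` BINDER OF dag-n11-w1 g3's `…OfBgFacts` CONSUMERS, AT EVERY H-EXTENSION OF THE MEMBER, FOR EVERY WINDOW `γ' ≤ θ.γ`**: per run in `]0, γ']` up to `K`, the bg
facts at EVERY length `k ≤ K` — NO run guard (the window restricts to `k` by `Step.InInterval`'s monotonicity in the length).
[cite: Balaban1988Convergent, (2.28) p.259, Thm 1 p.262 (bookkeeping)] -/
theorem bgFacts_ccmwCRH_of_thm1GaugeR_of_hcomp_of_hjm {θH : Stage13HParams F N} (hH : θH.toStage13Params = θ) (hθ : θ = theta13LiveOfNumerics F N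
      ({ stage12NumericsOfThm1CCMW F.L j γ ε₀ B₃ B₃' a₀ a₁ with s2 := { sect2NumericsOfThm1C F.L with cR := c } } : Stage12Numerics) ε₂₉
      (zeta316OfRecord F N (stage12NumericsOfThm1CCMW F.L j γ ε₀ B₃ B₃' a₀ a₁).ν (stage12NumericsOfThm1CCMW F.L j γ ε₀ B₃ B₃' a₀ a₁).τ9.M
        (stage12NumericsOfThm1CCMW F.L j γ ε₀ B₃ B₃' a₀ a₁).A₁) (RzOfRecord F N) (ZtOfRecord F N))
    (hjm : j + 1 ≤ F.m) (hc0 : 0 < c) (hc8 : c ≤ 8) (hγ0 : 0 < γ) (hγ : γ ≤ 1 / 2) (hε : 0 < ε₀) (hε' : 0 < ε₂₉) (hB : 0 ≤ B₃) (hB' : 0 ≤ B₃') (ha₀ : 0 < a₀) (ha₁ : 0 < a₁)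
    (h15 : VariationalThm1RegSepCoP7M F N B₃ a₀ a₁) (hc₁₅ : c₁₅ ≤ F.L ^ j) (h15G : VariationalThm1GaugeRegSepCoP7MR F N (F.L ^ j) c₁₅ B₃ B₃' a₀ a₁)
    (hcomp : ∀ (p : B12.RunParams) (n : ℕ), n ≤ p.K → Step.InInterval θ.γ n (gOfRecord₁₃ F N θ p) → ∀ m, m < n →
      θ.s2.cR * epsOfRecord θ.ν (gOfRecord₁₃ F N θ p) m ≤ 2 * (θ.s2.cR * epsOfRecord θ.ν (gOfRecord₁₃ F N θ p) (m + 1)))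
    (hcompRev : ∀ (p : B12.RunParams) (n : ℕ), n ≤ p.K → Step.InInterval θ.γ n (gOfRecord₁₃ F N θ p) → ∀ m, m < n →
      θ.s2.cR * epsOfRecord θ.ν (gOfRecord₁₃ F N θ p) (m + 1) ≤ 2 * (θ.s2.cR * epsOfRecord θ.ν (gOfRecord₁₃ F N θ p) m)) {γ' : ℝ} (hγ' : γ' ≤ θ.γ) :
    ∀ P : B12.RunParams, Step.InInterval γ' P.K (gOfRecord₁₃ F N θH.toStage13Params P) → ∀ k, k ≤ P.K →
      BgProvisoΛ F N P.K (settingOfRecord₁₃ F N θH.toStage13Params P) (θH.Rz P.K) θH.τ9.M k (suppOfRecord₁₃SepCoP F N θH.toStage13Params P k)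
        (UbgOfRecord₁₃CoP F N θH.toStage13Params P k) := by
  subst hH
  intro P hw k hk
  exact bgProvisoΛ_ccmwCR_of_thm1GaugeR_of_hcomp_of_hjm hθ hjm hc0 hc8 hγ0 hγ hε hε' hB hB' ha₀ ha₁ h15 hc₁₅ h15G hcomp hcompRev P k hk
    (fun m hm => ⟨(hw m (hm.trans hk)).1, (hw m (hm.trans hk)).2.trans hγ'⟩)

end Summit.QuantumFields.YangMills.Theorems.BalabanUVNodesN11BgRowGaugeRAtCRLetteredMember

end
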